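import Summits.PneNP.PneNP.Theorems.ChebyshevTracialDesignTwoCutoffBound
import Summits.PneNP.PneNP.Theorems.ChebyshevTracialDesignExtendedSignDirectional
import Literature.Combinatorics.Optimization.TracialDesignsLowDegreeProofs
import HarnessLib

/-!
# Cell pnp-psdrank, route `ChebyshevTracialDesign`: the SIGN cell at ALL Gram degrees `k ≤ c' = (t−1)/2` — Grigoriev's full positivity range —
# plain and directional, via the half-degree containment law (crux `TracialDecayExp20`, stmt-PneNP-19878)

Brick 94b (prover g18; MEMO-20 §2(c)/§4(1), MEMO-21 §1). Bricks 89/90/90b read the per-matching exact level law of a Gram cut factor of Johnson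
degree `k` through `lowdeg_sum_law` (`deg P_M ≤ 2k`), which forces the Gram cutoff `2k ≤ c'` (the `2k+1` extrapolation nodes `1,…,4k+1` must be
real levels `≤ t = 2c'+1`). The Literature half-degree law `lowdeg_sum_law_sharp` (littype-FN2-1 g13: the level polynomial of a containment event
`1[A ⊆ U]` has degree `⌊|A|/2⌋`, so `deg P_M ≤ k`) halves the cutoff, and the two-cutoff bound of brick 94a (`…TwoCutoffBound`) does the rest:
* §1 **`exists_avgLevelLaw_of_lowDegree_sharp`** — for a cut factor `A` of Johnson degree `≤ k ≤ c'+1` and psd `Y_M`: the averaged exact level law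
  of `(A Aᵀ, Y)` is a polynomial of degree `≤ k` with nonnegative virtual value; **`exists_avgLevelLaw_proj_of_rangeLowDegree_sharp`** — the same
  for a FIXED contraction field `X` against idempotents `P_M` whose compressions `P_M X_U P_M = A^{(M)}_U (A^{(M)}_U)ᵀ` are Gram fields of Johnson
  degree `≤ k` in `U`, matching by matching (brick 88b/90b's directional hypothesis).
* §2 **`value_le_of_lowDegree_allModes_sharp`** / **`value_proj_le_of_rangeLowDegree_allModes_sharp`** (`D ≤ k ≤ c'`):
  `≤ r·(B_v√P_D + 2^{k+1}√P_k + Σ_{κ∈(D/2,k/2]} R_κ√A_κ)`; **`value_le_of_lowDegree_above_design_sharp`** /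
  **`value_proj_le_of_rangeLowDegree_above_design_sharp`**: `≤ (2^{k+1} + B_v)·r√P_D`.
Compared with bricks 89/90/90b (`D ≤ 2k ≤ c'`; constants `2^{2k+1}`, `√P_{2k}`, modes up to `k`): the Gram degree budget doubles to `c' = (t−1)/2`
(`≍ n/8` for balanced cuts) — exactly Grigoriev's knapsack positivity range `k < t/2 + 1` up to the one node lost to extrapolation — and at equal
`k` the extrapolation constant drops from `2^{2k+1}` to `2^{k+1}`. For `k < D` the sharp brick 23 (`sum_levelWeight_trace_nonpos_of_lowDegree_sharp`,
Literature) already gives `≤ 0`, and `IsLowDegreeU` is monotone in `k`, so `D ≤ k` is no restriction.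
[cite: Grigoriev2001, Lemma 1.4 (PDF p. 8)] [cite: Rothvoss2017, §2 (PDF p. 6)] [cite: GriblingDelaatLaurent2019, §5]
[cite: BrouwerHaemers2012, Thm. 4.9.1 (PDF p. 93)] [cite: CoppersmithRivlin1992, Thm. (p. 970)]
Stature: support/instrument (kernel lane, no defs, axioms standard). WHAT THIS IS NOT: nothing on fields without a low-degree Gram factor (in the
tested directions), no proof or refutation of `TracialDecayExp20`, nothing on psd rank of P_PM(K_n), no P-vs-NP content. Supports stmt-PneNP-19878.
-/

set_option linter.dupNamespace false -- `Summit.PneNP.PneNP.…`: summit = sub-problem (D-0017)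

noncomputable section

namespace Summit.PneNP.PneNP.Theorems.ChebyshevTracialDesignExtendedSignSharp

open Finset Matrix Polynomial Literature.Barriers.PneNP Literature.Combinatorics.SimpleGraph.CycleSpace
open Literature.Computability.Complexity Literature.Combinatorics.Optimization
open Summit.PneNP.PneNP.Theorems.ChebyshevTracialDesignJunta
open Summit.PneNP.PneNP.Theorems.ChebyshevTracialDesignTracialProfilePolynomial (level_sum_eq_sum_Qset)
open Summit.PneNP.PneNP.Theorems.ChebyshevTracialDesignProfilePolynomial (card_pmatch_pos)
open Summit.PneNP.PneNP.Theorems.ChebyshevTracialDesignLevelNormalisation (card_Qset_eq)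
open Summit.PneNP.PneNP.Theorems.ChebyshevTracialDesignAdaptedLowDegree (trace_mul_proj_eq)
open Summit.PneNP.PneNP.Theorems.ChebyshevTracialDesignTwoCutoffBound
open Literature.Combinatorics.Optimization.ChebyshevTracialDesignJunta (lowdeg_sum_law_sharp)
open scoped MatrixOrder

variable {n : ℕ}

/-! ### §1 Averaged exact level laws from Grigoriev's knapsack positivity, at the half degree -/

/-- **THE AVERAGED EXACT LEVEL LAW OF A LOW-DEGREE GRAM CUT FACTOR, SHARP DEGREE.** For `n` even with `2t+2 ≤ n`, `t = 2c'+1`, a cut factor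
`A : OddSet n → ℝ^{r×m}` of Johnson degree `≤ k` with `k ≤ c'+1` (Grigoriev's range `k − 1 < t/2`), and any psd family `Y` on the perfect
matchings, there is a real polynomial `Ps` of degree `≤ k` with `Ps(0) ≥ 0` such that `Σ_{(U,M) ∈ Q_c(t)} tr(A_U A_Uᵀ Y_M) = |Q_c(t)|·Ps(c)` at
every odd level `c ≤ t`. Per matching this is `lowdeg_sum_law_sharp` (half-degree containment law + Grigoriev's knapsack Lemma 1.4); `Ps` is the
average `|PM|⁻¹ Σ_M P_M`. [cite: Grigoriev2001, Lemma 1.4 (PDF p. 8)] [cite: Rothvoss2017, §2 (PDF p. 6)] -/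
theorem exists_avgLevelLaw_of_lowDegree_sharp {c' : ℕ} (hn : Even n) (htn : 2 * (2 * c' + 1) + 2 ≤ n) {r m k : ℕ} (hkc : k ≤ c' + 1)
    (A : OddSet n → Matrix (Fin r) (Fin m) ℝ) (hA : IsLowDegreeU n k A)
    (Y : PMatch n → Matrix (Fin r) (Fin r) ℝ) (hY : ∀ M, (Y M).PosSemidef) :
    ∃ Ps : Polynomial ℝ, Ps.natDegree ≤ k ∧ 0 ≤ Ps.eval 0 ∧
      ∀ mm : ℕ, mm ≤ c' → ∑ q ∈ Qset n (2 * c' + 1) (2 * mm + 1), (A q.1 * (A q.1)ᵀ * Y q.2).trace =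
        ((Qset n (2 * c' + 1) (2 * mm + 1)).card : ℝ) * Ps.eval ((2 * mm + 1 : ℕ) : ℝ) := by
  classical
  have hG : Grigoriev2001_knapsackFormNonneg := Grigoriev2001_knapsackFormNonneg_holds
  set t := 2 * c' + 1 with htdef
  have htodd : Odd t := ⟨c', rfl⟩
  -- coefficients of the low-degree entries
  have hα' : ∀ a j, ∃ c : {A' : Finset (Fin n) // A'.card ≤ k} → ℝ,
      ∑ A', c A' • (fun U : OddSet n => if A'.1 ⊆ U.1 then (1 : ℝ) else 0) = fun U => A U a j :=
    fun a j => (Submodule.mem_span_range_iff_exists_fun ℝ).1 (hA a j)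
  choose α hα using hα'
  have hAeval : ∀ (U : OddSet n) a j,
      A U a j = ∑ A' : {A' : Finset (Fin n) // A'.card ≤ k}, α a j A' * (if A'.1 ⊆ U.1 then (1 : ℝ) else 0) := by
    intro U a j
    have := congrFun (hα a j) U
    rw [Finset.sum_apply] at this
    rw [← this]
    exact sum_congr rfl fun A' _ => by rw [Pi.smul_apply, smul_eq_mul]
  -- per matching: the exact polynomial level law of degree ≤ k with nonnegative virtual value
  have hN : ∀ M : PMatch n, M.1.card = n / 2 := fun M => by have := two_mul_card_pmatch M; omega
  have hP : ∀ M : PMatch n, ∃ P : Polynomial ℝ, P.natDegree ≤ k ∧ 0 ≤ P.eval 0 ∧ ∀ c i : ℕ, c + 2 * i = t →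
      ∑ U : OddSet n, (if U.1.card = t ∧ cc U M = c then (A U * (A U)ᵀ * Y M).trace else 0) =
        (((n / 2).choose (c + i) * (c + i).choose i * 2 ^ c : ℕ) : ℝ) * P.eval (c : ℝ) := by
    intro M
    have hMt : t + 1 ≤ M.1.card := by have := two_mul_card_pmatch M; omega
    have hk : 2 * k ≤ M.1.card := by omega
    have hr₁ : (k : ℝ) - 1 < (t : ℝ) / 2 := by
      have : (2 : ℝ) * k ≤ t + 1 := by exact_mod_cast (show 2 * k ≤ t + 1 by omega)
      linarith
    have hr₂ : (t : ℝ) / 2 < (M.1.card : ℝ) - k + 1 := by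
      have h1 : (2 : ℝ) * k ≤ t + 1 := by exact_mod_cast (show 2 * k ≤ t + 1 by omega)
      have h2 : (t : ℝ) + 1 ≤ M.1.card := by exact_mod_cast hMt
      linarith
    obtain ⟨P, hPdeg, hP0, hPval⟩ := lowdeg_sum_law_sharp hG M hk hr₁ hr₂ α (Y M) (hY M)
    refine ⟨P, hPdeg, hP0, fun c i hci => ?_⟩
    rw [sum_oddSet_level_eq M hci (fun U => A U * (A U)ᵀ) Y, ← hN M, ← hPval c i hci]
    refine sum_congr rfl fun U' hU' => ?_
    have hodd : Odd U'.card := by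
      obtain ⟨-, hc, hi⟩ := mem_filter.1 hU'
      have h := card_eq_cr_add_two_mul_in M.2 (subset_univ U')
      rw [hc, hi, hci] at h
      exact h ▸ htodd
    rw [dif_pos hodd, trace_mul_transpose_mul_eq]
    refine sum_congr rfl fun j _ => sum_congr rfl fun a _ => sum_congr rfl fun b _ => ?_
    rw [hAeval ⟨U', hodd⟩ a j, hAeval ⟨U', hodd⟩ b j]
  choose P hPdeg hP0 hPval using hP
  have hPm : (0 : ℝ) < Fintype.card (PMatch n) := by exact_mod_cast card_pmatch_pos hn
  -- the averaged exact polynomial `P♯ = |PM|⁻¹·Σ_M P_M`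
  refine ⟨Polynomial.C ((Fintype.card (PMatch n) : ℝ)⁻¹) * ∑ M : PMatch n, P M, ?_, ?_, fun mm hmm => ?_⟩
  · refine (natDegree_C_mul_le _ _).trans ?_
    exact Polynomial.natDegree_sum_le_of_forall_le _ _ fun M _ => hPdeg M
  · rw [eval_mul, eval_C, eval_finsetSum]
    exact mul_nonneg (inv_nonneg.2 hPm.le) (sum_nonneg fun M _ => hP0 M)
  · have hci : (2 * mm + 1) + 2 * (c' - mm) = t := by omega
    rw [eval_mul, eval_C, eval_finsetSum, ← level_sum_eq_sum_Qset t (2 * mm + 1) (fun U M => (A U * (A U)ᵀ * Y M).trace),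
      sum_congr rfl fun M _ => hPval M (2 * mm + 1) (c' - mm) hci, ← mul_sum, card_Qset_eq hmm,
      show 2 * mm + 1 + (c' - mm) = n / 2 - (n / 2 - (2 * mm + 1 + (c' - mm))) by omega]
    have e : ((2 * mm + 1 : ℕ) : ℝ) = ((2 * mm + 1 : ℕ) : ℝ) := rfl
    rw [show n / 2 - (n / 2 - (2 * mm + 1 + (c' - mm))) = 2 * mm + 1 + (c' - mm) by omega]
    field_simp

/-- **THE AVERAGED EXACT LEVEL LAW IN THE DIRECTIONAL FORM, SHARP DEGREE.** For `n` even with `2t+2 ≤ n`, `t = 2c'+1`, a field `X` on the odd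
cuts, idempotents `P_M` (`P_M² = P_M`), and, for every perfect matching `M` separately, a Gram representation `P_M X_U P_M = A^{(M)}_U (A^{(M)}_U)ᵀ`
with `A^{(M)}` of Johnson degree `≤ k ≤ c'+1` in `U`: there is a real polynomial `Ps` of degree `≤ k` with `Ps(0) ≥ 0` and
`Σ_{(U,M) ∈ Q_c(t)} tr(X_U P_M) = |Q_c(t)|·Ps(c)` at every odd level `c ≤ t` (`tr(X_U P_M) = tr(P_M X_U P_M)`; `lowdeg_sum_law_sharp` with `Y = 1`
per matching — its proof is pointwise in `M`). [cite: Grigoriev2001, Lemma 1.4 (PDF p. 8)] [cite: Rothvoss2017, §2 (PDF p. 6)] -/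
theorem exists_avgLevelLaw_proj_of_rangeLowDegree_sharp {c' : ℕ} (hn : Even n) (htn : 2 * (2 * c' + 1) + 2 ≤ n) {r m k : ℕ}
    (hkc : k ≤ c' + 1) (X : OddSet n → Matrix (Fin r) (Fin r) ℝ)
    (P : PMatch n → Matrix (Fin r) (Fin r) ℝ) (hP2 : ∀ M, P M * P M = P M)
    (A : PMatch n → OddSet n → Matrix (Fin r) (Fin m) ℝ) (hA : ∀ M, IsLowDegreeU n k (A M))
    (hXP : ∀ M U, P M * X U * P M = A M U * (A M U)ᵀ) :
    ∃ Ps : Polynomial ℝ, Ps.natDegree ≤ k ∧ 0 ≤ Ps.eval 0 ∧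
      ∀ mm : ℕ, mm ≤ c' → ∑ q ∈ Qset n (2 * c' + 1) (2 * mm + 1), (X q.1 * P q.2).trace =
        ((Qset n (2 * c' + 1) (2 * mm + 1)).card : ℝ) * Ps.eval ((2 * mm + 1 : ℕ) : ℝ) := by
  classical
  have hG : Grigoriev2001_knapsackFormNonneg := Grigoriev2001_knapsackFormNonneg_holds
  set t := 2 * c' + 1 with htdef
  have htodd : Odd t := ⟨c', rfl⟩
  -- coefficients of the low-degree entries, per matching
  have hα' : ∀ M a j, ∃ c : {A' : Finset (Fin n) // A'.card ≤ k} → ℝ,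
      ∑ A', c A' • (fun U : OddSet n => if A'.1 ⊆ U.1 then (1 : ℝ) else 0) = fun U => A M U a j :=
    fun M a j => (Submodule.mem_span_range_iff_exists_fun ℝ).1 (hA M a j)
  choose α hα using hα'
  have hAeval : ∀ (M : PMatch n) (U : OddSet n) a j,
      A M U a j = ∑ A' : {A' : Finset (Fin n) // A'.card ≤ k}, α M a j A' * (if A'.1 ⊆ U.1 then (1 : ℝ) else 0) := by
    intro M U a j
    have := congrFun (hα M a j) U
    rw [Finset.sum_apply] at this
    rw [← this]
    exact sum_congr rfl fun A' _ => by rw [Pi.smul_apply, smul_eq_mul]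
  -- the compressed trace, per matching
  have htrP : ∀ (M : PMatch n) (U : OddSet n), (X U * P M).trace = (A M U * (A M U)ᵀ * (1 : Matrix (Fin r) (Fin r) ℝ)).trace :=
    fun M U => by rw [trace_mul_proj_eq (X U) (P M) (hP2 M), hXP M U, Matrix.mul_one]
  -- per matching: the exact polynomial level law of degree ≤ k with nonnegative virtual value
  have hN : ∀ M : PMatch n, M.1.card = n / 2 := fun M => by have := two_mul_card_pmatch M; omega
  have hQ : ∀ M : PMatch n, ∃ Q : Polynomial ℝ, Q.natDegree ≤ k ∧ 0 ≤ Q.eval 0 ∧ ∀ c i : ℕ, c + 2 * i = t →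
      ∑ U : OddSet n, (if U.1.card = t ∧ cc U M = c then (X U * P M).trace else 0) =
        (((n / 2).choose (c + i) * (c + i).choose i * 2 ^ c : ℕ) : ℝ) * Q.eval (c : ℝ) := by
    intro M
    have hMt : t + 1 ≤ M.1.card := by have := two_mul_card_pmatch M; omega
    have hk : 2 * k ≤ M.1.card := by omega
    have hr₁ : (k : ℝ) - 1 < (t : ℝ) / 2 := by
      have : (2 : ℝ) * k ≤ t + 1 := by exact_mod_cast (show 2 * k ≤ t + 1 by omega)
      linarith
    have hr₂ : (t : ℝ) / 2 < (M.1.card : ℝ) - k + 1 := by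
      have h1 : (2 : ℝ) * k ≤ t + 1 := by exact_mod_cast (show 2 * k ≤ t + 1 by omega)
      have h2 : (t : ℝ) + 1 ≤ M.1.card := by exact_mod_cast hMt
      linarith
    obtain ⟨Q, hQdeg, hQ0, hQval⟩ := lowdeg_sum_law_sharp hG M hk hr₁ hr₂ (α M) (1 : Matrix (Fin r) (Fin r) ℝ) Matrix.PosSemidef.one
    refine ⟨Q, hQdeg, hQ0, fun c i hci => ?_⟩
    have hre : ∑ U : OddSet n, (if U.1.card = t ∧ cc U M = c then (X U * P M).trace else 0) =
        ∑ U : OddSet n, (if U.1.card = t ∧ cc U M = c then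
          ((fun U : OddSet n => A M U * (A M U)ᵀ) U * (fun _ : PMatch n => (1 : Matrix (Fin r) (Fin r) ℝ)) M).trace else 0) :=
      sum_congr rfl fun U _ => by rw [htrP M U]
    rw [hre, sum_oddSet_level_eq M hci (fun U => A M U * (A M U)ᵀ) (fun _ => (1 : Matrix (Fin r) (Fin r) ℝ)), ← hN M, ← hQval c i hci]
    refine sum_congr rfl fun U' hU' => ?_
    have hodd : Odd U'.card := by
      obtain ⟨-, hc, hi⟩ := mem_filter.1 hU'
      have h := card_eq_cr_add_two_mul_in M.2 (subset_univ U')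
      rw [hc, hi, hci] at h
      exact h ▸ htodd
    rw [dif_pos hodd]
    show (A M ⟨U', hodd⟩ * (A M ⟨U', hodd⟩)ᵀ * (1 : Matrix (Fin r) (Fin r) ℝ)).trace = _
    rw [trace_mul_transpose_mul_eq]
    refine sum_congr rfl fun j _ => sum_congr rfl fun a _ => sum_congr rfl fun b _ => ?_
    rw [hAeval M ⟨U', hodd⟩ a j, hAeval M ⟨U', hodd⟩ b j]
  choose Q hQdeg hQ0 hQval using hQ
  have hPm : (0 : ℝ) < Fintype.card (PMatch n) := by exact_mod_cast card_pmatch_pos hn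
  -- the averaged exact polynomial `|PM|⁻¹·Σ_M Q_M`
  refine ⟨Polynomial.C ((Fintype.card (PMatch n) : ℝ)⁻¹) * ∑ M : PMatch n, Q M, ?_, ?_, fun mm hmm => ?_⟩
  · refine (natDegree_C_mul_le _ _).trans ?_
    exact Polynomial.natDegree_sum_le_of_forall_le _ _ fun M _ => hQdeg M
  · rw [eval_mul, eval_C, eval_finsetSum]
    exact mul_nonneg (inv_nonneg.2 hPm.le) (sum_nonneg fun M _ => hQ0 M)
  · have hci : (2 * mm + 1) + 2 * (c' - mm) = t := by omega
    rw [eval_mul, eval_C, eval_finsetSum, ← level_sum_eq_sum_Qset t (2 * mm + 1) (fun U M => (X U * P M).trace),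
      sum_congr rfl fun M _ => hQval M (2 * mm + 1) (c' - mm) hci, ← mul_sum, card_Qset_eq hmm]
    field_simp

/-! ### §2 The SIGN cell at all Gram degrees `k ≤ c'` -/

/-- **THE SIGN CELL AT ALL GRAM DEGREES `k ≤ c'`, r-UNIFORM (sharp form of brick 90).** For `n` even, an exact design `(n, t = 2c'+1, T, D, B_v, C, w)`
with `D ≤ 2c'`, `D ≤ k ≤ c'`, a cut factor `A : OddSet n → ℝ^{r×m}` of Johnson degree `≤ k` with `A_U A_Uᵀ ⪯ I`, and any psd-contraction family
`Y`: `Σ_{U,M} levelWeight(U,M)·tr(A_U A_Uᵀ Y_M) ≤ r·(B_v·√P_D + 2^{k+1}·√P_k + Σ_{κ ∈ (D/2, k/2]} R_κ·√A_κ)`. (For `k < D` brick 23's sharp form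
`sum_levelWeight_trace_nonpos_of_lowDegree_sharp` gives `≤ 0`; `IsLowDegreeU` is monotone in `k`, so `D ≤ k` is no restriction.)
[cite: Grigoriev2001, Lemma 1.4 (PDF p. 8)] [cite: Rothvoss2017, §2 (PDF p. 6)] [cite: GriblingDelaatLaurent2019, §5]
[cite: BrouwerHaemers2012, Thm. 4.9.1 (PDF p. 93)] [cite: CoppersmithRivlin1992, Thm. (p. 970)] -/
theorem value_le_of_lowDegree_allModes_sharp {c' T D : ℕ} {Bv : ℝ} {C : Finset ℕ} {w : ℕ → ℝ} (hn : Even n)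
    (hdes : IsExactDesign n (2 * c' + 1) T D Bv C w) (hD : D ≤ 2 * c') {r m k : ℕ} (hDk : D ≤ k) (hkc : k ≤ c')
    (A : OddSet n → Matrix (Fin r) (Fin m) ℝ) (hA : IsLowDegreeU n k A) (hA1 : ∀ U, (1 - A U * (A U)ᵀ).PosSemidef)
    (Y : PMatch n → Matrix (Fin r) (Fin r) ℝ) (hY : ∀ M, (Y M).PosSemidef ∧ (1 - Y M).PosSemidef) :
    ∑ U, ∑ M, levelWeight n (2 * c' + 1) C w U M * (A U * (A U)ᵀ * Y M).trace ≤
      (r : ℝ) * (Bv * Real.sqrt (∏ i ∈ range (D / 2 + 1), ((2 * i + 1 : ℝ) / ((n : ℝ) - 2 * i))) +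
        2 ^ (k + 1) * Real.sqrt (∏ i ∈ range (k / 2 + 1), ((2 * i + 1 : ℝ) / ((n : ℝ) - 2 * i))) +
        ∑ κ ∈ Ico (D / 2 + 1) (k / 2 + 1),
          (∏ i ∈ range κ, (((2 * c' + 1 : ℝ) - 2 * i) * ((n : ℝ) - 2 * c' - 1 - 2 * i) /
              (((2 * c' : ℝ) - 2 * i) * ((n : ℝ) - 2 * c' - 2 - 2 * i)))) *
            Real.sqrt (∏ i ∈ range κ, ((2 * i + 1 : ℝ) / ((n : ℝ) - 2 * i)))) := by
  have hXpsd : ∀ U : OddSet n, (A U * (A U)ᵀ).PosSemidef := fun U => by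
    simpa [Matrix.conjTranspose_eq_transpose_of_trivial] using Matrix.posSemidef_self_mul_conjTranspose (A U)
  obtain ⟨Ps, hPsdeg, hPs0, hlaw⟩ :=
    exists_avgLevelLaw_of_lowDegree_sharp hn hdes.2.1 (by omega) A hA Y fun M => (hY M).1
  exact value_le_of_avgLevelLaw_allModes hn hdes hD hDk hkc (fun U => A U * (A U)ᵀ) (fun U => ⟨hXpsd U, hA1 U⟩) Y hY Ps hPsdeg hPs0 hlaw

/-- **THE SIGN CELL ABOVE THE DESIGN DEGREE, SHARP (brick 89 at `D ≤ k ≤ c'`).** Same data: `Σ W·tr(A_U A_Uᵀ Y_M) ≤ (2^{k+1} + B_v)·r·√P_D`.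
[cite: Grigoriev2001, Lemma 1.4 (PDF p. 8)] [cite: Rothvoss2017, §2 (PDF p. 6)] [cite: CoppersmithRivlin1992, Thm. (p. 970)] -/
theorem value_le_of_lowDegree_above_design_sharp {c' T D : ℕ} {Bv : ℝ} {C : Finset ℕ} {w : ℕ → ℝ} (hn : Even n)
    (hdes : IsExactDesign n (2 * c' + 1) T D Bv C w) {r m k : ℕ} (hDk : D ≤ k) (hkc : k ≤ c')
    (A : OddSet n → Matrix (Fin r) (Fin m) ℝ) (hA : IsLowDegreeU n k A) (hA1 : ∀ U, (1 - A U * (A U)ᵀ).PosSemidef)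
    (Y : PMatch n → Matrix (Fin r) (Fin r) ℝ) (hY : ∀ M, (Y M).PosSemidef ∧ (1 - Y M).PosSemidef) :
    ∑ U, ∑ M, levelWeight n (2 * c' + 1) C w U M * (A U * (A U)ᵀ * Y M).trace ≤
      (2 ^ (k + 1) + Bv) * ((r : ℝ) * Real.sqrt (∏ i ∈ range (D / 2 + 1), ((2 * i + 1 : ℝ) / ((n : ℝ) - 2 * i)))) := by
  have hXpsd : ∀ U : OddSet n, (A U * (A U)ᵀ).PosSemidef := fun U => by
    simpa [Matrix.conjTranspose_eq_transpose_of_trivial] using Matrix.posSemidef_self_mul_conjTranspose (A U)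
  obtain ⟨Ps, hPsdeg, hPs0, hlaw⟩ :=
    exists_avgLevelLaw_of_lowDegree_sharp hn hdes.2.1 (by omega) A hA Y fun M => (hY M).1
  exact value_le_of_avgLevelLaw_above_design hn hdes hDk hkc (fun U => A U * (A U)ᵀ) (fun U => ⟨hXpsd U, hA1 U⟩) Y hY Ps hPsdeg hPs0 hlaw

/-- **THE DIRECTIONAL SIGN CELL AT ALL GRAM DEGREES `k ≤ c'` (sharp form of brick 90b).** For `n` even, an exact design
`(n, t = 2c'+1, T, D ≤ 2c', B_v, C, w)`, `D ≤ k ≤ c'`; a contraction field `X`; idempotent psd contractions `P_M`; and for every `M` a Gram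
representation `P_M X_U P_M = A^{(M)}_U (A^{(M)}_U)ᵀ` with `A^{(M)}` of Johnson degree `≤ k` in `U`:
`Σ W·tr(X_U P_M) ≤ r·(B_v√P_D + 2^{k+1}√P_k + Σ_{κ∈(D/2,k/2]} R_κ√A_κ)`.
[cite: Grigoriev2001, Lemma 1.4 (PDF p. 8)] [cite: Rothvoss2017, §2 (PDF p. 6)] [cite: GriblingDelaatLaurent2019, §5]
[cite: BrouwerHaemers2012, Thm. 4.9.1 (PDF p. 93)] [cite: CoppersmithRivlin1992, Thm. (p. 970)] -/
theorem value_proj_le_of_rangeLowDegree_allModes_sharp {c' T D : ℕ} {Bv : ℝ} {C : Finset ℕ} {w : ℕ → ℝ} (hn : Even n)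
    (hdes : IsExactDesign n (2 * c' + 1) T D Bv C w) (hD : D ≤ 2 * c') {r m k : ℕ} (hDk : D ≤ k) (hkc : k ≤ c')
    (X : OddSet n → Matrix (Fin r) (Fin r) ℝ) (hX : ∀ U, (X U).PosSemidef ∧ (1 - X U).PosSemidef)
    (P : PMatch n → Matrix (Fin r) (Fin r) ℝ) (hP2 : ∀ M, P M * P M = P M) (hY : ∀ M, (P M).PosSemidef ∧ (1 - P M).PosSemidef)
    (A : PMatch n → OddSet n → Matrix (Fin r) (Fin m) ℝ) (hA : ∀ M, IsLowDegreeU n k (A M))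
    (hXP : ∀ M U, P M * X U * P M = A M U * (A M U)ᵀ) :
    ∑ U, ∑ M, levelWeight n (2 * c' + 1) C w U M * (X U * P M).trace ≤
      (r : ℝ) * (Bv * Real.sqrt (∏ i ∈ range (D / 2 + 1), ((2 * i + 1 : ℝ) / ((n : ℝ) - 2 * i))) +
        2 ^ (k + 1) * Real.sqrt (∏ i ∈ range (k / 2 + 1), ((2 * i + 1 : ℝ) / ((n : ℝ) - 2 * i))) +
        ∑ κ ∈ Ico (D / 2 + 1) (k / 2 + 1),
          (∏ i ∈ range κ, (((2 * c' + 1 : ℝ) - 2 * i) * ((n : ℝ) - 2 * c' - 1 - 2 * i) /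
              (((2 * c' : ℝ) - 2 * i) * ((n : ℝ) - 2 * c' - 2 - 2 * i)))) *
            Real.sqrt (∏ i ∈ range κ, ((2 * i + 1 : ℝ) / ((n : ℝ) - 2 * i)))) := by
  obtain ⟨Ps, hPsdeg, hPs0, hlaw⟩ := exists_avgLevelLaw_proj_of_rangeLowDegree_sharp hn hdes.2.1 (by omega) X P hP2 A hA hXP
  exact value_le_of_avgLevelLaw_allModes hn hdes hD hDk hkc X hX P hY Ps hPsdeg hPs0 hlaw

/-- **THE DIRECTIONAL SIGN CELL ABOVE THE DESIGN DEGREE, SHARP.** Same data with `D ≤ k ≤ c'`: `Σ W·tr(X_U P_M) ≤ (2^{k+1} + B_v)·r·√P_D`.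
[cite: Grigoriev2001, Lemma 1.4 (PDF p. 8)] [cite: Rothvoss2017, §2 (PDF p. 6)] [cite: CoppersmithRivlin1992, Thm. (p. 970)] -/
theorem value_proj_le_of_rangeLowDegree_above_design_sharp {c' T D : ℕ} {Bv : ℝ} {C : Finset ℕ} {w : ℕ → ℝ} (hn : Even n)
    (hdes : IsExactDesign n (2 * c' + 1) T D Bv C w) {r m k : ℕ} (hDk : D ≤ k) (hkc : k ≤ c')
    (X : OddSet n → Matrix (Fin r) (Fin r) ℝ) (hX : ∀ U, (X U).PosSemidef ∧ (1 - X U).PosSemidef)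
    (P : PMatch n → Matrix (Fin r) (Fin r) ℝ) (hP2 : ∀ M, P M * P M = P M) (hY : ∀ M, (P M).PosSemidef ∧ (1 - P M).PosSemidef)
    (A : PMatch n → OddSet n → Matrix (Fin r) (Fin m) ℝ) (hA : ∀ M, IsLowDegreeU n k (A M))
    (hXP : ∀ M U, P M * X U * P M = A M U * (A M U)ᵀ) :
    ∑ U, ∑ M, levelWeight n (2 * c' + 1) C w U M * (X U * P M).trace ≤
      (2 ^ (k + 1) + Bv) * ((r : ℝ) * Real.sqrt (∏ i ∈ range (D / 2 + 1), ((2 * i + 1 : ℝ) / ((n : ℝ) - 2 * i)))) := by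
  obtain ⟨Ps, hPsdeg, hPs0, hlaw⟩ := exists_avgLevelLaw_proj_of_rangeLowDegree_sharp hn hdes.2.1 (by omega) X P hP2 A hA hXP
  exact value_le_of_avgLevelLaw_above_design hn hdes hDk hkc X hX P hY Ps hPsdeg hPs0 hlaw

end Summit.PneNP.PneNP.Theorems.ChebyshevTracialDesignExtendedSignSharp

end
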